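import Summits.SmoothPoincare4.SmoothPoincare4.Theses.WeakReductionDescent
import Summits.SmoothPoincare4.SmoothPoincare4.Theses.GroupTrisection
import Summits.SmoothPoincare4.SmoothPoincare4.Theorems.DependentTripleAtThree.Negative.OfSmoothPoincare4
import Literature.Topology.FourManifolds.HomotopyS4CompactProofs
import Literature.Topology.FourManifolds.HomotopyS4OrientableProofs
import Literature.Topology.FourManifolds.TrisectionEulerProofs
import Literature.Topology.FourManifolds.TrisectionHandleDecompositionProofs

/-!
# SmoothPoincare4 / WeakReductionDescent — rung 3 (`DependentTripleAtThree`) follows from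
# item stmt-SmoothPoincare4-0435 (`GroupTrisection.GtriMorse1121`) and Gay–Kirby's Lemma 13

Crux item stmt-SmoothPoincare4-17999 (`Summit.SmoothPoincare4.SmoothPoincare4.Theses.WeakReductionDescent.DependentTripleAtThree`,
rank 4 of route WeakReductionDescent; line `Sketch`, card `poenaru-one-cork-up`, transfer to item 0435):
every MINIMAL genus-`3` Gay–Kirby trisection of a smooth homotopy 4-sphere admits a dependent triple.

At rung `3` "minimal" means "exotic": a diffeomorphism `M ≅ S⁴` pulls Gay–Kirby's genus-`0`
trisection of `S⁴` back to `M` (landed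
`Theorems.DependentTripleAtThree.Negative.not_minimal_three_of_diffeomorph`), so the crux follows by
VACUITY from "every smooth homotopy 4-sphere with a genus-`3` GK-trisection is `≅ S⁴`".  This file
certifies, sorry-free, that the latter — and hence the crux — follows from

* the tree's named fact `Literature.Topology.FourManifolds.gkTrisection_exists_isMorse_isSelfIndexing`
  (Gay–Kirby 2016, Lemma 13 / Meier–Schirmer–Zupan 2016 §4: a `(g; k₀,k₁,k₂)` GK-trisection of a
  closed connected oriented smooth 4-manifold gives a self-indexing Morse function with
  `(1, k₀, g − k₁, k₂, 1)` critical points; KNOWN, unproved in tree — taken as a hypothesis, so the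
  results here are CONDITIONAL on it), and
* item stmt-SmoothPoincare4-0435 `Summit.SmoothPoincare4.SmoothPoincare4.Theses.GroupTrisection.GtriMorse1121`
  (a closed smooth `M ≃ₕ S⁴` with a Morse function with one minimum, `≤ 1` critical point of index
  `1`, `≤ 1` of index `3` and one maximum is `≅ S⁴`; OPEN in its `(c₁,c₃) = (1,1)` case), taken as a
  hypothesis BY NAME.

The one observation beyond bookkeeping: NO Meier–Schirmer–Zupan input is needed to dispose of the
types `k ≠ (1,1,1)`.  For a genus-`3` GK-trisection of a homotopy sphere `Σ kᵢ = 3` UNCONDITIONALLY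
(`gkTrisection_genus_eq_sum_of_homotopyEquiv_sphere_holds`, PROVED), so two of the `kᵢ` are `≤ 1`, and
relabelling the sectors (`IsGKTrisection.comp_perm`, PROVED; Gay–Kirby's Def. 1 is symmetric) puts
them in the slots read by Lemma 13 as the `1`- and `3`-handle counts: the Morse function has profile
`(1, ≤1, ·, ≤1, 1)` — exactly the hypothesis of 0435 (`genusThree_morseOneOne_of_gkLemma13`).

* `genusThree_exists_perm_apply_le_one` — three naturals summing to `3` have two `≤ 1`, moved to
  slots `0`, `2` by a permutation of `Fin 3`.
* `genusThree_sum_k_eq_three` — `k 0 + k 1 + k 2 = 3` for a genus-`3` GK-trisection of `M ≃ₕ S⁴`.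
* `genusThree_morseOneOne_of_gkLemma13` — GK L13 ⇒ a Morse function of profile `(1, ≤1, ·, ≤1, 1)`.
* `genusThreeStandard_of_gtriMorse1121` — GK L13 → 0435 → every smooth homotopy 4-sphere with a
  genus-`3` GK-trisection (any type) is `≅ S⁴`.
* `dependentTripleAtThree_of_gtriMorse1121` — GK L13 → 0435 → the crux BY NAME (registered helper
  `helper_dependentTripleAtThree_of_gtriMorse1121` of the crux item).

Cross-route reading: rung 3 of WeakReductionDescent, the `(c₁,c₃) = (1,1)` case of GroupTrisection's
0435 and the Mazur × Mazur sector of ConvexBisection's crux stmt-SmoothPoincare4-3546 (whose skeleton m12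
registers `stub_gtriMorse1121` verbatim; `Theorems/ContractibleTwistedDoubleStandard/Negative/GtriMorse1121Sector.lean`)
are ONE open problem; this file is the kernel-checked arrow 0435 ⇒ rung 3 (modulo GK L13).
-/

noncomputable section

-- the registered namespace `Summit.SmoothPoincare4.SmoothPoincare4.Theorems` repeats a component
set_option linter.dupNamespace false

open scoped Manifold ContDiff Topology ContinuousMap
open Set Function Literature.Topology.FourManifolds
open Summit.SmoothPoincare4.SmoothPoincare4.Theses.WeakReductionDescent

namespace Summit.SmoothPoincare4.SmoothPoincare4.Theorems

section Glue

variable {M : Type} [TopologicalSpace M] [T2Space M] [SecondCountableTopology M]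
  [ChartedSpace (EuclideanSpace ℝ (Fin 4)) M] [IsManifold (𝓡 4) ∞ M]

/-- **Relabelling.** Three naturals summing to `3` contain two that are `≤ 1`; a permutation of
`Fin 3` moves them to the slots `0` and `2`. [folklore] -/
theorem genusThree_exists_perm_apply_le_one {k : Fin 3 → ℕ} (hk : k 0 + k 1 + k 2 = 3) :
    ∃ σ : Equiv.Perm (Fin 3), k (σ 0) ≤ 1 ∧ k (σ 2) ≤ 1 := by
  by_cases h0 : k 0 ≤ 1
  · by_cases h2 : k 2 ≤ 1
    · exact ⟨1, by simpa using h0, by simpa using h2⟩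
    · have h1 : k 1 ≤ 1 := by omega
      refine ⟨Equiv.swap 1 2, ?_, ?_⟩
      · rw [Equiv.swap_apply_of_ne_of_ne (by decide) (by decide)]; exact h0
      · rw [Equiv.swap_apply_right]; exact h1
  · have h1 : k 1 ≤ 1 := by omega
    have h2 : k 2 ≤ 1 := by omega
    refine ⟨Equiv.swap 0 1, ?_, ?_⟩
    · rw [Equiv.swap_apply_left]; exact h1
    · rw [Equiv.swap_apply_of_ne_of_ne (by decide) (by decide)]; exact h2

/-- **`Σ kᵢ = 3`, unconditionally**, for a genus-`3` GK-trisection of a smooth homotopy 4-sphere over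
the Statement's bare binders: compactness (`compactSpace_of_homotopyEquiv_sphere_four_holds`) and an
orientation (`isOrientable_of_homotopyEquiv_sphere_four_holds`) come from `e`, and the PROVED
Euler-characteristic fact `gkTrisection_genus_eq_sum_of_homotopyEquiv_sphere_holds` gives `3 = Σ kᵢ`.
[cite: GayKirby2016, Remark 2] -/
theorem genusThree_sum_k_eq_three (e : M ≃ₕ Metric.sphere (0 : EuclideanSpace ℝ (Fin 5)) 1)
    {k : Fin 3 → ℕ} {T : Fin 3 → Set M} (hT : IsGKTrisection M 3 k T) : k 0 + k 1 + k 2 = 3 := by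
  haveI : CompactSpace M := compactSpace_of_homotopyEquiv_sphere_four_holds M e
  obtain ⟨o⟩ := isOrientable_of_homotopyEquiv_sphere_four_holds M e
  exact (gkTrisection_genus_eq_sum_of_homotopyEquiv_sphere_holds M o 3 k T hT e).symm

/-- **The handle reading (Gay–Kirby Lemma 13 ⇒ profile `(1, ≤1, ·, ≤1, 1)`), conditional on the named
fact.**  Given `gkTrisection_exists_isMorse_isSelfIndexing`, a smooth homotopy 4-sphere with a genus-`3`
GK-trisection of ANY type `k` carries a Morse function with one minimum, `≤ 1` critical point of index
`1`, `≤ 1` of index `3` and one maximum: `Σ kᵢ = 3`, relabel so that `k (σ 0), k (σ 2) ≤ 1`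
(`genusThree_exists_perm_apply_le_one`), and read Lemma 13 for the relabelled trisection
(`gkTrisection_exists_isMorse_isSelfIndexing.comp_perm`); connectedness of `M` is transported from `S⁴`
along `e`. [cite: GayKirby2016, Lemma 13] -/
theorem genusThree_morseOneOne_of_gkLemma13 (hGK : gkTrisection_exists_isMorse_isSelfIndexing)
    (e : M ≃ₕ Metric.sphere (0 : EuclideanSpace ℝ (Fin 5)) 1) {k : Fin 3 → ℕ} {T : Fin 3 → Set M}
    (hT : IsGKTrisection M 3 k T) :
    ∃ f : M → ℝ, IsMorse (𝓡 4) f ∧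
      (criticalSetOfIndex (𝓡 4) f 0).ncard = 1 ∧ (criticalSetOfIndex (𝓡 4) f 1).ncard ≤ 1 ∧
      (criticalSetOfIndex (𝓡 4) f 3).ncard ≤ 1 ∧ (criticalSetOfIndex (𝓡 4) f 4).ncard = 1 := by
  haveI : CompactSpace M := compactSpace_of_homotopyEquiv_sphere_four_holds M e
  haveI : ConnectedSpace M := by
    haveI : PathConnectedSpace (Metric.sphere (0 : EuclideanSpace ℝ (Fin 5)) 1) :=
      pathConnectedSpace_sphere_four
    haveI : PathConnectedSpace M := pathConnectedSpace_of_homotopyEquiv e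
    infer_instance
  obtain ⟨o⟩ := isOrientable_of_homotopyEquiv_sphere_four_holds M e
  obtain ⟨σ, h0, h2⟩ := genusThree_exists_perm_apply_le_one (genusThree_sum_k_eq_three e hT)
  obtain ⟨f, hf, -, c0, c1, -, c3, c4⟩ := hGK.comp_perm o hT σ
  exact ⟨f, hf, c0, c1.trans_le h0, c3.trans_le h2, c4⟩

end Glue

/-- **GK Lemma 13 → item 0435 → every smooth homotopy 4-sphere with a genus-`3` GK-trisection is
`≅ S⁴`** (any type `k`; the manifold-level statement `GenusThreeStandard` of the line's Sketch, i.e. the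
`(3; k)` frontier of `Literature.Barriers.SmoothPoincare4.LowGenusTrisectionBarrier` over the corrected
predicate `IsGKTrisection`).  Conditional on the named fact; 0435 is an open item taken by name.
[cite: GayKirby2016, Lemma 13] -/
theorem genusThreeStandard_of_gtriMorse1121 (hGK : gkTrisection_exists_isMorse_isSelfIndexing)
    (h0435 : Summit.SmoothPoincare4.SmoothPoincare4.Theses.GroupTrisection.GtriMorse1121)
    (M : Type) [TopologicalSpace M] [T2Space M] [SecondCountableTopology M]
    [ChartedSpace (EuclideanSpace ℝ (Fin 4)) M] [IsManifold (𝓡 4) ∞ M]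
    (e : M ≃ₕ Metric.sphere (0 : EuclideanSpace ℝ (Fin 5)) 1) (k : Fin 3 → ℕ) (T : Fin 3 → Set M)
    (hT : IsGKTrisection M 3 k T) :
    Nonempty (M ≃ₘ⟮𝓡 4, 𝓡 4⟯ Metric.sphere (0 : EuclideanSpace ℝ (Fin 5)) 1) := by
  haveI : CompactSpace M := hT.compactSpace
  obtain ⟨f, hf, c0, c1, c3, c4⟩ := genusThree_morseOneOne_of_gkLemma13 hGK e hT
  exact h0435 M e f hf c0 c1 c3 c4

/-- **GK Lemma 13 → item 0435 → the crux `DependentTripleAtThree` BY NAME** (registered helper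
`helper_dependentTripleAtThree_of_gtriMorse1121` of item stmt-SmoothPoincare4-17999; the composition of
line `Sketch`).  For a minimal genus-`3` GK-trisection of `M ≃ₕ S⁴`, `genusThreeStandard_of_gtriMorse1121`
gives `Φ : M ≅ S⁴`, and `Φ` contradicts minimality (Gay–Kirby's genus-`0` trisection of `S⁴` pulled back,
`Theorems.DependentTripleAtThree.Negative.not_minimal_three_of_diffeomorph`): the rung is EMPTY and the
dependent triple exists vacuously.  CONDITIONAL on the named fact (GK L13) and on item 0435.
[cite: GayKirby2016, Lemma 13] -/
theorem dependentTripleAtThree_of_gtriMorse1121 :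
    Literature.Topology.FourManifolds.gkTrisection_exists_isMorse_isSelfIndexing →
    Summit.SmoothPoincare4.SmoothPoincare4.Theses.GroupTrisection.GtriMorse1121 →
    Summit.SmoothPoincare4.SmoothPoincare4.Theses.WeakReductionDescent.DependentTripleAtThree := by
  intro hGK h0435 M _ _ _ _ _ e k T hT hmin
  obtain ⟨Φ⟩ := genusThreeStandard_of_gtriMorse1121 hGK h0435 M e k T hT
  exact (DependentTripleAtThree.Negative.not_minimal_three_of_diffeomorph Φ hmin).elim

end Summit.SmoothPoincare4.SmoothPoincare4.Theorems

end
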